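import Summits.Ventures.LatticeQCDFlow.Scaling.HomLadderSharpLaw
import Summits.Ventures.LatticeQCDFlow.Scaling.UniversalPoincare

/-!
HONEST FRAMING: exact (Metropolis-corrected) sampling algorithms for lattice gauge theory; figures
of merit are autocorrelation/cost numbers at stated couplings and volumes; no continuum-physics
claim.

# SpiderSharpLaw — `b` LADDERS OF LENGTH `ℓ` SHARING ONE HOT SEAT (the list `r ↦ (r mod ℓ = 0 ? 0 : r, r+1)` on `Fin (bℓ+1)`, `m = K = bℓ`; `ℓ = 1` the star, `b = 1` the ladder):
# `max{bℓ(ℓ+1)(2ℓ+1)/(6t), (bℓ+1)/h} ≤ 1/ρ ≤ max{bℓ²(ℓ+1)/t, (1+b(2ℓ+1))/h}` AND **`((1−ρ)/ρ)·log((1−ν(u))·√((ℓ+1)/4)/4) ≤ t_mix(1/4) ≤ ⌈(1/ρ)·log(4h/ρ)⌉`** —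
# PARALLELISING ONE LADDER OF `K` LEVELS INTO `b` LADDERS OF `K/b` LEVELS DIVIDES THE TRANSPORT UNIT `K³/t` BY `b²` AND LEAVES THE REFRESH BUDGET `K/h` (lean-2 GEN-48, ours)

Venture-side (OURS).  Cell `lqcd-flow` (pub-lqcd), unit `pub-lqcd-lean-2-g48`, 2026-09-01.  Chapter AI (the sizes of the Robin ground state), file 14 — parents AI6 `HomLadderSharpLaw` (AI3's path
Poincaré, AI4 ∕ AI5's sharp law and `floorLog_mono`) and AI7 `UniversalPoincare`.  The SPIDER: `b ≥ 1` legs of `ℓ ≥ 1` cold levels each, every leg an adjacent ladder hanging from the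
common hot level `0`; level `r+1` (`r = p + ℓq`, leg `q`, position `p`) is listed with `0` when `p = 0` and with level `r` otherwise.  (§1) The spider's chains run along the legs (`L = ℓ`); AI7's `connected_of_reachable` gives connectivity.  (§2) THE PER-LEG POINCARÉ INEQUALITY: AI3's path inequality on each leg (hot level + `ℓ` levels), summed
over the legs with `finProdFinEquiv`, gives `Σ_kv_k² ≤ ℓ(ℓ+1)·Σ_r(v_{i_r} − v_{l_r})² + (1 + b(2ℓ+1))·v_0²`, so `min{t/(bℓ²(ℓ+1)), h/(1+b(2ℓ+1))} ≤ ρ`; the LINEAR TEST VECTOR on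
leg `0` (levels `1, …, ℓ`: `v_k = k`, zero elsewhere) has energy `tℓ/(bℓ)` and `Σv² = ℓ(ℓ+1)(2ℓ+1)/6`, so `ρ ≤ 6t/(bℓ(ℓ+1)(2ℓ+1))`; AI2's participation bound with the two ceilings gives
`Σc/√(Σc²) ≥ √((ℓ+1)/4)`.  (§3) AI4's sharp law.  READING: `1/ρ ≍ max{Kℓ²/t, K/h}` with `K = bℓ` — the star (`ℓ = 1`: `K/t`) and the ladder (`b = 1`: `K³/t`) are the ends of one
family; NOT CLAIMED: the floor's logarithm beyond `log ℓ` (the participation bound uses one leg's growth only; by symmetry the truth is `≍ log K`).  No definitions.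

* §1 `spiderList_ne`, `spiderList_reachable`, `spiderList_connected` (through AI7's `connected_of_reachable`); §2 `spiderList_leg_edge`, `spiderList_poincare`, `spiderList_rho_ge`, `spiderList_rho_le_linear`, `spiderList_participation_ge`;
  §3 `homSpider_sharp_two_sided`.

Literature grade (cell rule): OWN; nothing cited; no new bib keys.
-/

noncomputable section

open Finset Function Real
open Literature.Probability.MarkovChains

namespace Summit.Ventures.LatticeQCDFlow.Scaling

/-! ## §1 The spider list: chains and connectivity -/

section Spider
variable {S : Type*} [Fintype S] [DecidableEq S] {b ℓ : ℕ} {ν : S → ℝ} {M : Fin (b * ℓ + 1) → S → S → ℝ} {w : Fin (b * ℓ + 1) → ℝ} {t : ℝ}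
  {P : (Fin (b * ℓ + 1) → S) → (Fin (b * ℓ + 1) → S) → ℝ}

omit [Fintype S] [DecidableEq S] in
/-- The spider list has distinct endpoints. [ours] -/
theorem spiderList_ne (r : Fin (b * ℓ)) :
    ((fun r : Fin (b * ℓ) => ((if (r : ℕ) % ℓ = 0 then (0 : Fin (b * ℓ + 1)) else r.castSucc, r.succ) : Fin (b * ℓ + 1) × Fin (b * ℓ + 1))) r).1
      ≠ ((fun r : Fin (b * ℓ) => ((if (r : ℕ) % ℓ = 0 then (0 : Fin (b * ℓ + 1)) else r.castSucc, r.succ) : Fin (b * ℓ + 1) × Fin (b * ℓ + 1))) r).2 := by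
  dsimp only
  split_ifs with h
  · exact (Fin.succ_ne_zero r).symm
  · exact ne_of_lt Fin.castSucc_lt_succ

omit [Fintype S] [DecidableEq S] in
/-- **Every level of the spider is within `ℓ` pairs of the hot one** (`ℓ ≥ 1`): level `p + ℓq + 1` by the chain `0, ℓq+1, …, ℓq+p+1`. [ours] -/
theorem spiderList_reachable (hℓ : 1 ≤ ℓ) (k : Fin (b * ℓ + 1)) :
    ∃ n : ℕ, n ≤ ℓ ∧ ∃ γ : Fin (n + 1) → Fin (b * ℓ + 1), γ 0 = 0 ∧ γ (Fin.last n) = k ∧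
      ∀ j : Fin n, ∃ r : Fin (b * ℓ),
        (((fun r : Fin (b * ℓ) => ((if (r : ℕ) % ℓ = 0 then (0 : Fin (b * ℓ + 1)) else r.castSucc, r.succ) : Fin (b * ℓ + 1) × Fin (b * ℓ + 1))) r).1 = γ j.castSucc
          ∧ ((fun r : Fin (b * ℓ) => ((if (r : ℕ) % ℓ = 0 then (0 : Fin (b * ℓ + 1)) else r.castSucc, r.succ) : Fin (b * ℓ + 1) × Fin (b * ℓ + 1))) r).2 = γ j.succ)
        ∨ (((fun r : Fin (b * ℓ) => ((if (r : ℕ) % ℓ = 0 then (0 : Fin (b * ℓ + 1)) else r.castSucc, r.succ) : Fin (b * ℓ + 1) × Fin (b * ℓ + 1))) r).1 = γ j.succ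
          ∧ ((fun r : Fin (b * ℓ) => ((if (r : ℕ) % ℓ = 0 then (0 : Fin (b * ℓ + 1)) else r.castSucc, r.succ) : Fin (b * ℓ + 1) × Fin (b * ℓ + 1))) r).2 = γ j.castSucc) := by
  by_cases hk0 : (k : ℕ) = 0
  · refine ⟨0, Nat.zero_le _, fun _ => 0, rfl, Fin.ext (by simp [hk0]), fun j => Fin.elim0 j⟩
  · -- `k = r + 1`, `r = p + ℓq`
    set r : ℕ := (k : ℕ) - 1 with hr
    have hrk : (k : ℕ) = r + 1 := by omega
    have hrlt : r < b * ℓ := by have := k.2; omega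
    set p : ℕ := r % ℓ with hp
    set q : ℕ := r / ℓ with hq
    have hpl : p < ℓ := Nat.mod_lt _ (by omega)
    have hdecomp : r = p + ℓ * q := by rw [hp, hq]; exact (Nat.mod_add_div r ℓ).symm
    refine ⟨p + 1, by omega, fun i => ⟨(i : ℕ) + (if (i : ℕ) = 0 then 0 else ℓ * q), ?_⟩, ?_, ?_, ?_⟩
    · have := i.2; split_ifs <;> omega
    · ext; simp
    · ext; simp only [Fin.val_last]; rw [if_neg (by omega)]; omega
    · intro j
      refine ⟨⟨(j : ℕ) + ℓ * q, by have := j.2; omega⟩, Or.inl ⟨?_, ?_⟩⟩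
      · -- first component
        by_cases hj : (j : ℕ) = 0
        · have hmod : ((j : ℕ) + ℓ * q) % ℓ = 0 := by rw [hj, zero_add, Nat.mul_mod_right]
          dsimp only
          rw [if_pos hmod]
          ext
          simp [hj]
        · have hmod : ((j : ℕ) + ℓ * q) % ℓ ≠ 0 := by
            rw [Nat.add_mul_mod_self_left, Nat.mod_eq_of_lt (by have := j.2; omega)]; exact hj
          dsimp only
          rw [if_neg hmod]
          ext
          simp [hj]
      · ext; simp only [Fin.val_succ]; rw [if_neg (by omega)]; omega

omit [Fintype S] [DecidableEq S] in
/-- **The spider list is connected** (`ℓ ≥ 1`). [ours] -/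
theorem spiderList_connected (hℓ : 1 ≤ ℓ) (A : Finset (Fin (b * ℓ + 1))) (hA : A.Nonempty) (hAu : A ≠ univ) :
    ∃ r : Fin (b * ℓ),
      (((fun r : Fin (b * ℓ) => ((if (r : ℕ) % ℓ = 0 then (0 : Fin (b * ℓ + 1)) else r.castSucc, r.succ) : Fin (b * ℓ + 1) × Fin (b * ℓ + 1))) r).1 ∈ A
        ∧ ((fun r : Fin (b * ℓ) => ((if (r : ℕ) % ℓ = 0 then (0 : Fin (b * ℓ + 1)) else r.castSucc, r.succ) : Fin (b * ℓ + 1) × Fin (b * ℓ + 1))) r).2 ∉ A)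
      ∨ (((fun r : Fin (b * ℓ) => ((if (r : ℕ) % ℓ = 0 then (0 : Fin (b * ℓ + 1)) else r.castSucc, r.succ) : Fin (b * ℓ + 1) × Fin (b * ℓ + 1))) r).2 ∈ A
        ∧ ((fun r : Fin (b * ℓ) => ((if (r : ℕ) % ℓ = 0 then (0 : Fin (b * ℓ + 1)) else r.castSucc, r.succ) : Fin (b * ℓ + 1) × Fin (b * ℓ + 1))) r).1 ∉ A) :=
  connected_of_reachable _ (spiderList_reachable hℓ) A hA hAu

/-! ## §2 The sizes -/

omit [Fintype S] [DecidableEq S] in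
/-- The entry `r = p + ℓq` seen from leg `q`: its second endpoint is level `p + ℓq + 1`, its first is `0` when `p = 0` and level `p + ℓq` otherwise — as values. [ours] -/
theorem spiderList_leg_edge (q : Fin b) (p : Fin ℓ) :
    ((((finProdFinEquiv (q, p) : Fin (b * ℓ)).succ : Fin (b * ℓ + 1)) : ℕ) = (p : ℕ) + ℓ * q + 1)
      ∧ ((p : ℕ) = 0 → (if ((finProdFinEquiv (q, p) : Fin (b * ℓ)) : ℕ) % ℓ = 0 then (0 : Fin (b * ℓ + 1)) else (finProdFinEquiv (q, p) : Fin (b * ℓ)).castSucc) = 0)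
      ∧ ((p : ℕ) ≠ 0 → (((if ((finProdFinEquiv (q, p) : Fin (b * ℓ)) : ℕ) % ℓ = 0 then (0 : Fin (b * ℓ + 1)) else (finProdFinEquiv (q, p) : Fin (b * ℓ)).castSucc) : Fin (b * ℓ + 1)) : ℕ)
        = (p : ℕ) + ℓ * q) := by
  have hval : ((finProdFinEquiv (q, p) : Fin (b * ℓ)) : ℕ) = (p : ℕ) + ℓ * q := finProdFinEquiv_apply_val (q, p)
  have hmod : ((finProdFinEquiv (q, p) : Fin (b * ℓ)) : ℕ) % ℓ = p := by
    rw [hval, Nat.add_mul_mod_self_left, Nat.mod_eq_of_lt p.2]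
  refine ⟨by rw [Fin.val_succ, hval], fun hp0 => ?_, fun hp0 => ?_⟩
  · rw [if_pos (by rw [hmod]; exact hp0)]
  · rw [if_neg (by rw [hmod]; exact hp0), Fin.val_castSucc, hval]

omit [Fintype S] [DecidableEq S] in
/-- **THE PER-LEG POINCARÉ INEQUALITY:** `Σ_kv_k² ≤ ℓ(ℓ+1)·Σ_r(v_{i_r} − v_{l_r})² + (1 + b(2ℓ+1))·v_0²`. [ours] -/
theorem spiderList_poincare (v : Fin (b * ℓ + 1) → ℝ) :
    ∑ k : Fin (b * ℓ + 1), v k ^ 2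
      ≤ (ℓ : ℝ) * (ℓ + 1) * ∑ r : Fin (b * ℓ),
          (v ((fun r : Fin (b * ℓ) => ((if (r : ℕ) % ℓ = 0 then (0 : Fin (b * ℓ + 1)) else r.castSucc, r.succ) : Fin (b * ℓ + 1) × Fin (b * ℓ + 1))) r).1
            - v ((fun r : Fin (b * ℓ) => ((if (r : ℕ) % ℓ = 0 then (0 : Fin (b * ℓ + 1)) else r.castSucc, r.succ) : Fin (b * ℓ + 1) × Fin (b * ℓ + 1))) r).2) ^ 2
        + (1 + (b : ℝ) * (2 * ℓ + 1)) * v 0 ^ 2 := by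
  -- abbreviations
  set E : Fin (b * ℓ) → ℝ := fun r =>
    (v ((fun r : Fin (b * ℓ) => ((if (r : ℕ) % ℓ = 0 then (0 : Fin (b * ℓ + 1)) else r.castSucc, r.succ) : Fin (b * ℓ + 1) × Fin (b * ℓ + 1))) r).1
      - v ((fun r : Fin (b * ℓ) => ((if (r : ℕ) % ℓ = 0 then (0 : Fin (b * ℓ + 1)) else r.castSucc, r.succ) : Fin (b * ℓ + 1) × Fin (b * ℓ + 1))) r).2) ^ 2 with hE
  -- reindex levels and entries by (leg, position)
  have hlev : ∑ k : Fin (b * ℓ + 1), v k ^ 2 = v 0 ^ 2 + ∑ q : Fin b, ∑ p : Fin ℓ, v (finProdFinEquiv (q, p)).succ ^ 2 := by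
    rw [Fin.sum_univ_succ, ← Equiv.sum_comp finProdFinEquiv (fun r : Fin (b * ℓ) => v r.succ ^ 2), Fintype.sum_prod_type]
  have hent : ∑ r : Fin (b * ℓ), E r = ∑ q : Fin b, ∑ p : Fin ℓ, E (finProdFinEquiv (q, p)) := by
    rw [← Equiv.sum_comp finProdFinEquiv E, Fintype.sum_prod_type]
  -- each leg is a path hanging from `0`
  have hleg : ∀ q : Fin b, ∑ p : Fin ℓ, v (finProdFinEquiv (q, p)).succ ^ 2 ≤ (ℓ : ℝ) * (ℓ + 1) * ∑ p : Fin ℓ, E (finProdFinEquiv (q, p)) + (2 * ((ℓ : ℝ) + 1) - 1) * v 0 ^ 2 := by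
    intro q
    set wq : ℕ → ℝ := fun j => if j = 0 then v 0 else if hj : j - 1 < ℓ then v (finProdFinEquiv (q, ⟨j - 1, hj⟩)).succ else 0 with hwq
    have hw0 : wq 0 = v 0 := by rw [hwq]; simp
    have hwsucc : ∀ p : Fin ℓ, wq ((p : ℕ) + 1) = v (finProdFinEquiv (q, p)).succ := by
      intro p; rw [hwq]; simp only [Nat.add_one_ne_zero, if_false, Nat.add_sub_cancel, dif_pos p.2, Fin.eta]
    have hpath := path_poincare_nat ℓ wq
    -- left side: `Σ_{j ≤ ℓ} wq j² = v_0² + Σ_p v(level(q,p))²`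
    have hL : ∑ j ∈ range (ℓ + 1), wq j ^ 2 = v 0 ^ 2 + ∑ p : Fin ℓ, v (finProdFinEquiv (q, p)).succ ^ 2 := by
      rw [Finset.sum_range_succ', hw0, add_comm, ← Fin.sum_univ_eq_sum_range (fun j => wq (j + 1) ^ 2) ℓ]
      congr 1
      exact sum_congr rfl fun p _ => by rw [hwsucc]
    -- the differences are the leg's entries
    have hD : ∑ j ∈ range ℓ, (wq (j + 1) - wq j) ^ 2 = ∑ p : Fin ℓ, E (finProdFinEquiv (q, p)) := by
      rw [← Fin.sum_univ_eq_sum_range (fun j => (wq (j + 1) - wq j) ^ 2) ℓ]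
      refine sum_congr rfl fun p _ => ?_
      obtain ⟨h2, h1z, h1s⟩ := spiderList_leg_edge (b := b) q p
      rw [hE]; dsimp only
      rw [hwsucc p]
      -- the second endpoint is `level(q,p)`
      have hsnd : ((fun r : Fin (b * ℓ) => ((if (r : ℕ) % ℓ = 0 then (0 : Fin (b * ℓ + 1)) else r.castSucc, r.succ) : Fin (b * ℓ + 1) × Fin (b * ℓ + 1))) (finProdFinEquiv (q, p))).2
          = (finProdFinEquiv (q, p)).succ := rfl
      by_cases hp0 : (p : ℕ) = 0
      · have hfst := h1z hp0
        rw [hfst, hp0, hw0]; ring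
      · have hfst := h1s hp0
        -- `wq p = v(level(q,p-1))` and `level(q,p-1)` is the first endpoint
        have hbd : (p : ℕ) + ℓ * q < b * ℓ + 1 := by
          have := (finProdFinEquiv (q, p) : Fin (b * ℓ)).2
          rw [finProdFinEquiv_apply_val] at this
          omega
        have hwp : wq (p : ℕ) = v ⟨(p : ℕ) + ℓ * q, hbd⟩ := by
          rw [hwq]; simp only [hp0, if_false]
          have hlt : (p : ℕ) - 1 < ℓ := by have := p.2; omega
          rw [dif_pos hlt]
          congr 1; ext; simp only [Fin.val_succ, finProdFinEquiv_apply_val]; omega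
        have hfst' : (if ((finProdFinEquiv (q, p) : Fin (b * ℓ)) : ℕ) % ℓ = 0 then (0 : Fin (b * ℓ + 1)) else (finProdFinEquiv (q, p) : Fin (b * ℓ)).castSucc)
            = ⟨(p : ℕ) + ℓ * q, hbd⟩ := Fin.ext hfst
        rw [hfst', hwp]; ring
    rw [hL, hD, hw0] at hpath
    linarith
  -- sum over the legs
  have hsum := sum_le_sum fun q (_ : q ∈ (univ : Finset (Fin b))) => hleg q
  rw [sum_add_distrib, ← mul_sum, sum_const, card_univ, Fintype.card_fin, nsmul_eq_mul] at hsum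
  rw [hlev, hent]
  nlinarith [hsum, sq_nonneg (v 0)]

omit [Fintype S] [DecidableEq S] in
/-- **THE SPIDER'S RATE FLOOR: `min{t/(ℓ(ℓ+1)·bℓ), h/(1 + b(2ℓ+1))} ≤ ρ`** for a positive solution (`b, ℓ ≥ 1`, `t, h > 0`). [ours] -/
theorem spiderList_rho_ge (hb : 1 ≤ b) (hℓ : 1 ≤ ℓ) (ht : 0 < t) {h ρ : ℝ} (hh : 0 < h) {c : Fin (b * ℓ + 1) → ℝ} (hc : ∀ k, 0 < c k)
    (hvertex : ∀ k : Fin (b * ℓ + 1), t / ((b * ℓ : ℕ) : ℝ) * ∑ r : Fin (b * ℓ),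
        ((if k = ((fun r : Fin (b * ℓ) => ((if (r : ℕ) % ℓ = 0 then (0 : Fin (b * ℓ + 1)) else r.castSucc, r.succ) : Fin (b * ℓ + 1) × Fin (b * ℓ + 1))) r).1
            then c ((fun r : Fin (b * ℓ) => ((if (r : ℕ) % ℓ = 0 then (0 : Fin (b * ℓ + 1)) else r.castSucc, r.succ) : Fin (b * ℓ + 1) × Fin (b * ℓ + 1))) r).2
              - c ((fun r : Fin (b * ℓ) => ((if (r : ℕ) % ℓ = 0 then (0 : Fin (b * ℓ + 1)) else r.castSucc, r.succ) : Fin (b * ℓ + 1) × Fin (b * ℓ + 1))) r).1 else 0)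
        + (if k = ((fun r : Fin (b * ℓ) => ((if (r : ℕ) % ℓ = 0 then (0 : Fin (b * ℓ + 1)) else r.castSucc, r.succ) : Fin (b * ℓ + 1) × Fin (b * ℓ + 1))) r).2
            then c ((fun r : Fin (b * ℓ) => ((if (r : ℕ) % ℓ = 0 then (0 : Fin (b * ℓ + 1)) else r.castSucc, r.succ) : Fin (b * ℓ + 1) × Fin (b * ℓ + 1))) r).1
              - c ((fun r : Fin (b * ℓ) => ((if (r : ℕ) % ℓ = 0 then (0 : Fin (b * ℓ + 1)) else r.castSucc, r.succ) : Fin (b * ℓ + 1) × Fin (b * ℓ + 1))) r).2 else 0))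
      - (if k = 0 then h * c k else 0) = -ρ * c k) :
    min (t / ((ℓ : ℝ) * (ℓ + 1) * ((b * ℓ : ℕ) : ℝ))) (h / (1 + (b : ℝ) * (2 * ℓ + 1))) ≤ ρ := by
  have hbl : 1 ≤ b * ℓ := Nat.one_le_iff_ne_zero.mpr (Nat.mul_ne_zero (by omega) (by omega))
  have hℓpos : (0 : ℝ) < ℓ := Nat.cast_pos.mpr (by omega)
  exact groundState_rho_ge_min _ hbl ht hh hc hvertex (a := (ℓ : ℝ) * (ℓ + 1)) (b := 1 + (b : ℝ) * (2 * ℓ + 1)) (by positivity) (by positivity) spiderList_poincare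

omit [Fintype S] [DecidableEq S] in
/-- **THE LINEAR TEST VECTOR ON ONE LEG: `ρ ≤ 6t/(bℓ·(ℓ+1)(2ℓ+1))`** for a positive solution (`b, ℓ ≥ 1`, `t ≥ 0`). [ours] -/
theorem spiderList_rho_le_linear (hb : 1 ≤ b) (hℓ : 1 ≤ ℓ) (ht : 0 ≤ t) {h ρ : ℝ} {c : Fin (b * ℓ + 1) → ℝ} (hc : ∀ k, 0 < c k)
    (hvertex : ∀ k : Fin (b * ℓ + 1), t / ((b * ℓ : ℕ) : ℝ) * ∑ r : Fin (b * ℓ),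
        ((if k = ((fun r : Fin (b * ℓ) => ((if (r : ℕ) % ℓ = 0 then (0 : Fin (b * ℓ + 1)) else r.castSucc, r.succ) : Fin (b * ℓ + 1) × Fin (b * ℓ + 1))) r).1
            then c ((fun r : Fin (b * ℓ) => ((if (r : ℕ) % ℓ = 0 then (0 : Fin (b * ℓ + 1)) else r.castSucc, r.succ) : Fin (b * ℓ + 1) × Fin (b * ℓ + 1))) r).2
              - c ((fun r : Fin (b * ℓ) => ((if (r : ℕ) % ℓ = 0 then (0 : Fin (b * ℓ + 1)) else r.castSucc, r.succ) : Fin (b * ℓ + 1) × Fin (b * ℓ + 1))) r).1 else 0)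
        + (if k = ((fun r : Fin (b * ℓ) => ((if (r : ℕ) % ℓ = 0 then (0 : Fin (b * ℓ + 1)) else r.castSucc, r.succ) : Fin (b * ℓ + 1) × Fin (b * ℓ + 1))) r).2
            then c ((fun r : Fin (b * ℓ) => ((if (r : ℕ) % ℓ = 0 then (0 : Fin (b * ℓ + 1)) else r.castSucc, r.succ) : Fin (b * ℓ + 1) × Fin (b * ℓ + 1))) r).1
              - c ((fun r : Fin (b * ℓ) => ((if (r : ℕ) % ℓ = 0 then (0 : Fin (b * ℓ + 1)) else r.castSucc, r.succ) : Fin (b * ℓ + 1) × Fin (b * ℓ + 1))) r).2 else 0))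
      - (if k = 0 then h * c k else 0) = -ρ * c k) :
    ρ ≤ 6 * t / (((b * ℓ : ℕ) : ℝ) * ((ℓ : ℝ) + 1) * (2 * ℓ + 1)) := by
  have hbl : 1 ≤ b * ℓ := Nat.one_le_iff_ne_zero.mpr (Nat.mul_ne_zero (by omega) (by omega))
  have hKpos : (0 : ℝ) < ((b * ℓ : ℕ) : ℝ) := Nat.cast_pos.mpr (by omega)
  have hℓpos : (0 : ℝ) < ℓ := Nat.cast_pos.mpr (by omega)
  -- the test vector: `v_k = k` on levels `1..ℓ` (leg 0), `0` elsewhere (and at `0`)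
  have hr := groundState_rayleigh _ hc ht hvertex (fun k => if (k : ℕ) ≤ ℓ then ((k : ℕ) : ℝ) else 0)
  dsimp only at hr
  -- energy terms: `1` on the first `ℓ` entries, `0` after
  have hE : ∀ r : Fin (b * ℓ), ((if (((if (r : ℕ) % ℓ = 0 then (0 : Fin (b * ℓ + 1)) else r.castSucc) : Fin (b * ℓ + 1)) : ℕ) ≤ ℓ
        then ((((if (r : ℕ) % ℓ = 0 then (0 : Fin (b * ℓ + 1)) else r.castSucc) : Fin (b * ℓ + 1)) : ℕ) : ℝ) else 0)
        - (if ((r.succ : Fin (b * ℓ + 1)) : ℕ) ≤ ℓ then (((r.succ : Fin (b * ℓ + 1)) : ℕ) : ℝ) else 0)) ^ 2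
        = if (r : ℕ) < ℓ then 1 else 0 := by
    intro r
    rw [Fin.val_succ]
    by_cases h0 : (r : ℕ) % ℓ = 0
    · rw [if_pos h0, Fin.val_zero, if_pos (Nat.zero_le _)]
      by_cases hrl : (r : ℕ) < ℓ
      · have hr0 : (r : ℕ) = 0 := by rwa [Nat.mod_eq_of_lt hrl] at h0
        rw [if_pos (show (r : ℕ) + 1 ≤ ℓ by omega), if_pos hrl, hr0]; push_cast; ring
      · rw [if_neg (show ¬((r : ℕ) + 1 ≤ ℓ) by omega), if_neg hrl]; push_cast; ring
    · rw [if_neg h0, Fin.val_castSucc]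
      by_cases hrl : (r : ℕ) < ℓ
      · rw [if_pos (show (r : ℕ) ≤ ℓ by omega), if_pos (show (r : ℕ) + 1 ≤ ℓ by omega), if_pos hrl]; push_cast; ring
      · have hrgt : ℓ < (r : ℕ) := by
          rcases Nat.lt_or_ge (r : ℕ) ℓ with h' | h'
          · exact absurd h' hrl
          · rcases Nat.eq_or_lt_of_le h' with h'' | h''
            · exfalso; apply h0; rw [← h'', Nat.mod_self]
            · exact h''
        rw [if_neg (show ¬((r : ℕ) ≤ ℓ) by omega), if_neg (show ¬((r : ℕ) + 1 ≤ ℓ) by omega), if_neg hrl]; ring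
  simp_rw [hE] at hr
  have hEsum : ∑ r : Fin (b * ℓ), (if (r : ℕ) < ℓ then (1 : ℝ) else 0) = ℓ := by
    rw [Fin.sum_univ_eq_sum_range (fun i => if i < ℓ then (1 : ℝ) else 0) (b * ℓ)]
    have hsplit : ∑ i ∈ range (b * ℓ), (if i < ℓ then (1 : ℝ) else 0) = ∑ i ∈ range ℓ, (if i < ℓ then (1 : ℝ) else 0) := by
      refine (sum_subset (fun i hi => mem_range.mpr (lt_of_lt_of_le (mem_range.mp hi) (by nlinarith))) fun i _ hi => ?_).symm
      rw [mem_range] at hi; rw [if_neg hi]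
    rw [hsplit]
    have : ∑ i ∈ range ℓ, (if i < ℓ then (1 : ℝ) else 0) = ∑ _i ∈ range ℓ, (1 : ℝ) := sum_congr rfl fun i hi => by rw [if_pos (mem_range.mp hi)]
    rw [this, sum_const, card_range, nsmul_eq_mul, mul_one]
  have hV : ∑ k : Fin (b * ℓ + 1), (if (k : ℕ) ≤ ℓ then ((k : ℕ) : ℝ) else 0) ^ 2 = (ℓ : ℝ) * (ℓ + 1) * (2 * ℓ + 1) / 6 := by
    rw [Fin.sum_univ_eq_sum_range (fun i => (if i ≤ ℓ then ((i : ℕ) : ℝ) else 0) ^ 2) (b * ℓ + 1)]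
    have hsplit : ∑ i ∈ range (b * ℓ + 1), (if i ≤ ℓ then ((i : ℕ) : ℝ) else 0) ^ 2 = ∑ i ∈ range (ℓ + 1), (if i ≤ ℓ then ((i : ℕ) : ℝ) else 0) ^ 2 := by
      refine (sum_subset (fun i hi => mem_range.mpr (by have := mem_range.mp hi; nlinarith)) fun i _ hi => ?_).symm
      rw [mem_range] at hi; rw [if_neg (by omega)]; ring
    rw [hsplit]
    have : ∑ i ∈ range (ℓ + 1), (if i ≤ ℓ then ((i : ℕ) : ℝ) else 0) ^ 2 = ∑ i ∈ range (ℓ + 1), ((i : ℕ) : ℝ) ^ 2 :=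
      sum_congr rfl fun i hi => by rw [if_pos (Nat.lt_succ_iff.mp (mem_range.mp hi))]
    rw [this, sum_range_sq_real]
  rw [hEsum, hV, Fin.val_zero] at hr
  simp only [Nat.zero_le, if_true, Nat.cast_zero] at hr
  have h0 : ((0 : ℝ)) ^ 2 = 0 := by norm_num
  rw [h0, mul_zero, add_zero] at hr
  -- `ρ·ℓ(ℓ+1)(2ℓ+1)/6 ≤ (t/(bℓ))·ℓ`
  rw [le_div_iff₀ (by positivity)]
  have := mul_le_mul_of_nonneg_left hr hKpos.le
  have hcancel : ((b * ℓ : ℕ) : ℝ) * (t / ((b * ℓ : ℕ) : ℝ) * (ℓ : ℝ)) = t * ℓ := by field_simp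
  rw [hcancel] at this
  nlinarith [this, hℓpos]

omit [Fintype S] [DecidableEq S] in
/-- **THE PARTICIPATION OF THE SPIDER'S GROUND STATE: `√((ℓ+1)/4) ≤ Σc/√(Σc²)`** (positive solution, `ρ > 0`, `b, ℓ ≥ 1`, `t, h > 0`). [ours] -/
theorem spiderList_participation_ge (hb : 1 ≤ b) (hℓ : 1 ≤ ℓ) (ht : 0 < t) {h ρ : ℝ} (hh : 0 < h) (hρ : 0 < ρ) {c : Fin (b * ℓ + 1) → ℝ} (hc : ∀ k, 0 < c k)
    (hvertex : ∀ k : Fin (b * ℓ + 1), t / ((b * ℓ : ℕ) : ℝ) * ∑ r : Fin (b * ℓ),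
        ((if k = ((fun r : Fin (b * ℓ) => ((if (r : ℕ) % ℓ = 0 then (0 : Fin (b * ℓ + 1)) else r.castSucc, r.succ) : Fin (b * ℓ + 1) × Fin (b * ℓ + 1))) r).1
            then c ((fun r : Fin (b * ℓ) => ((if (r : ℕ) % ℓ = 0 then (0 : Fin (b * ℓ + 1)) else r.castSucc, r.succ) : Fin (b * ℓ + 1) × Fin (b * ℓ + 1))) r).2
              - c ((fun r : Fin (b * ℓ) => ((if (r : ℕ) % ℓ = 0 then (0 : Fin (b * ℓ + 1)) else r.castSucc, r.succ) : Fin (b * ℓ + 1) × Fin (b * ℓ + 1))) r).1 else 0)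
        + (if k = ((fun r : Fin (b * ℓ) => ((if (r : ℕ) % ℓ = 0 then (0 : Fin (b * ℓ + 1)) else r.castSucc, r.succ) : Fin (b * ℓ + 1) × Fin (b * ℓ + 1))) r).2
            then c ((fun r : Fin (b * ℓ) => ((if (r : ℕ) % ℓ = 0 then (0 : Fin (b * ℓ + 1)) else r.castSucc, r.succ) : Fin (b * ℓ + 1) × Fin (b * ℓ + 1))) r).1
              - c ((fun r : Fin (b * ℓ) => ((if (r : ℕ) % ℓ = 0 then (0 : Fin (b * ℓ + 1)) else r.castSucc, r.succ) : Fin (b * ℓ + 1) × Fin (b * ℓ + 1))) r).2 else 0))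
      - (if k = 0 then h * c k else 0) = -ρ * c k) :
    Real.sqrt (((ℓ : ℝ) + 1) / 4) ≤ (∑ k : Fin (b * ℓ + 1), c k) / Real.sqrt (∑ k : Fin (b * ℓ + 1), c k ^ 2) := by
  have hbl : 1 ≤ b * ℓ := Nat.one_le_iff_ne_zero.mpr (Nat.mul_ne_zero (by omega) (by omega))
  have hKpos : (0 : ℝ) < ((b * ℓ : ℕ) : ℝ) := Nat.cast_pos.mpr (by omega)
  have hℓpos : (0 : ℝ) < ℓ := Nat.cast_pos.mpr (by omega)
  have hℓK : (ℓ : ℝ) ≤ ((b * ℓ : ℕ) : ℝ) := by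
    have : ℓ ≤ b * ℓ := Nat.le_mul_of_pos_left ℓ (by omega)
    exact_mod_cast this
  have hpart := groundState_participation_ge _ hbl ht hρ hc hvertex ℓ (spiderList_reachable hℓ)
  refine le_trans (Real.sqrt_le_sqrt ?_) hpart
  have hlin := spiderList_rho_le_linear hb hℓ ht.le hc hvertex
  have hhot := groundState_rho_le_hot _ hc ht.le hvertex
  have hq : 0 < 1 + (ℓ : ℝ) * (((b * ℓ : ℕ) : ℝ) * h / t) := by positivity
  rw [div_le_div_iff₀ (by norm_num) (mul_pos hρ hq)]
  have hexp : ((ℓ : ℝ) + 1) * (ρ * (1 + (ℓ : ℝ) * (((b * ℓ : ℕ) : ℝ) * h / t))) = ((ℓ : ℝ) + 1) * ρ + ((ℓ : ℝ) + 1) * ρ * ℓ * ((b * ℓ : ℕ) : ℝ) * h / t := by ring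
  rw [hexp]
  -- `(ℓ+1)ρ ≤ h` since `ℓ ≤ bℓ` and `ρ(bℓ+1) ≤ h`
  have h1 : ((ℓ : ℝ) + 1) * ρ ≤ h := by nlinarith
  have h2 : ((ℓ : ℝ) + 1) * ρ * ℓ * ((b * ℓ : ℕ) : ℝ) * h / t ≤ 3 * h := by
    rw [div_le_iff₀ ht]
    rcases le_or_gt ((ℓ : ℝ) * ((b * ℓ : ℕ) : ℝ) * h) t with hsmall | hlarge
    · have : ((ℓ : ℝ) + 1) * ρ * ℓ * ((b * ℓ : ℕ) : ℝ) * h = (((ℓ : ℝ) + 1) * ρ) * ((ℓ : ℝ) * ((b * ℓ : ℕ) : ℝ) * h) := by ring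
      rw [this]
      calc (((ℓ : ℝ) + 1) * ρ) * ((ℓ : ℝ) * ((b * ℓ : ℕ) : ℝ) * h) ≤ h * t := mul_le_mul h1 hsmall (by positivity) hh.le
        _ ≤ 3 * h * t := by nlinarith
    · have hρ' : ρ * (((b * ℓ : ℕ) : ℝ) * ((ℓ : ℝ) + 1) * (2 * ℓ + 1)) ≤ 6 * t := by
        have := hlin; rwa [le_div_iff₀ (by positivity)] at this
      have hstep : ((ℓ : ℝ) + 1) * ρ * ℓ * ((b * ℓ : ℕ) : ℝ) * h * (2 * ℓ + 1) ≤ 6 * t * (ℓ * h) := by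
        have : ((ℓ : ℝ) + 1) * ρ * ℓ * ((b * ℓ : ℕ) : ℝ) * h * (2 * ℓ + 1) = (ρ * (((b * ℓ : ℕ) : ℝ) * ((ℓ : ℝ) + 1) * (2 * ℓ + 1))) * (ℓ * h) := by ring
        rw [this]; exact mul_le_mul_of_nonneg_right hρ' (by positivity)
      nlinarith [hstep, mul_pos hℓpos hh, mul_pos (mul_pos hℓpos hh) ht]
  linarith

/-! ## §3 The sharp law on the spider -/

/-- **THE HOMOGENEOUS EXCHANGE SCHEME ON `b` LADDERS OF LENGTH `ℓ` SHARING THE HOT SEAT:** `b, ℓ ≥ 1`, `0 < t < 1`, `w` a probability vector with `w_0 > 0`, one positive law `ν`, exact hot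
sampler, idle cold kernels, `P = t·ptGraphSwap ν^{⊗} spider 1 + (1−t)·prodKernel w M`, `h = (1−t)w_0`; then there is `ρ` with `bℓ(ℓ+1)(2ℓ+1)/(6t) ≤ 1/ρ`, `(bℓ+1)/h ≤ 1/ρ`,
`min{t/(ℓ(ℓ+1)·bℓ), h/(1+b(2ℓ+1))} ≤ ρ` and, for every content `u`, **`((1−ρ)/ρ)·log((1−ν(u))·√((ℓ+1)/4)/4) ≤ t_mix(1/4) ≤ ⌈(1/ρ)·log(4h/ρ)⌉`**. [ours] -/
theorem homSpider_sharp_two_sided (hb : 1 ≤ b) (hℓ : 1 ≤ ℓ) (hν : ∀ v, 0 < ν v) (hν1 : ∑ v, ν v = 1) (hM0 : ∀ u v, M 0 u v = ν v)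
    (hidle : ∀ i : Fin (b * ℓ), ∀ u v, M i.succ u v = if v = u then 1 else 0) (hw0 : ∀ k, 0 ≤ w k) (hw00 : 0 < w 0) (hw1 : ∑ k, w k = 1) (ht0 : 0 < t) (ht1 : t < 1)
    (hP : ∀ x y, P x y = t * ptGraphSwap (fun _ : Fin (b * ℓ + 1) => ν)
        (fun r : Fin (b * ℓ) => ((if (r : ℕ) % ℓ = 0 then (0 : Fin (b * ℓ + 1)) else r.castSucc, r.succ) : Fin (b * ℓ + 1) × Fin (b * ℓ + 1))) (fun _ => Equiv.refl S) x y
      + (1 - t) * prodKernel w M x y) (u : S) :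
    ∃ ρ : ℝ, 0 < ρ ∧ ((b * ℓ : ℕ) : ℝ) * ((ℓ : ℝ) + 1) * (2 * ℓ + 1) / (6 * t) ≤ 1 / ρ ∧ (((b * ℓ : ℕ) : ℝ) + 1) / ((1 - t) * w 0) ≤ 1 / ρ ∧
      min (t / ((ℓ : ℝ) * (ℓ + 1) * ((b * ℓ : ℕ) : ℝ))) ((1 - t) * w 0 / (1 + (b : ℝ) * (2 * ℓ + 1))) ≤ ρ ∧
      (1 - ρ) / ρ * Real.log ((1 - ν u) * Real.sqrt (((ℓ : ℝ) + 1) / 4) / 4) ≤ (mixingTime P (tensorFun (fun _ : Fin (b * ℓ + 1) => ν)) (1 / 4) : ℝ) ∧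
      mixingTime P (tensorFun (fun _ : Fin (b * ℓ + 1) => ν)) (1 / 4) ≤ ⌈1 / ρ * Real.log (4 * ((1 - t) * w 0) / ρ)⌉₊ := by
  have hbl : 1 ≤ b * ℓ := Nat.one_le_iff_ne_zero.mpr (Nat.mul_ne_zero (by omega) (by omega))
  have hKpos : (0 : ℝ) < ((b * ℓ : ℕ) : ℝ) := Nat.cast_pos.mpr (by omega)
  have hhh : 0 < (1 - t) * w 0 := mul_pos (by linarith) hw00
  have he := spiderList_ne (b := b) (ℓ := ℓ)
  obtain ⟨c, ρ, hcpos, hcS, hρ0, hρle, hvertex⟩ := graph_groundState_exists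
    (fun r : Fin (b * ℓ) => ((if (r : ℕ) % ℓ = 0 then (0 : Fin (b * ℓ + 1)) else r.castSucc, r.succ) : Fin (b * ℓ + 1) × Fin (b * ℓ + 1))) (t := t) (h := (1 - t) * w 0)
    hbl ht0 hhh (spiderList_connected hℓ)
  have htwo := graphScheme_sharp_two_sided_mode
    (fun r : Fin (b * ℓ) => ((if (r : ℕ) % ℓ = 0 then (0 : Fin (b * ℓ + 1)) else r.castSucc, r.succ) : Fin (b * ℓ + 1) × Fin (b * ℓ + 1))) hbl he hν hν1 hM0 hidle hw0 hw00 hw1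
    ht0 ht1 hP hρ0 hcpos hvertex u
  have hlin := spiderList_rho_le_linear hb hℓ ht0.le hcpos hvertex
  have hfloorρ := spiderList_rho_ge hb hℓ ht0 hhh hcpos hvertex
  have hpart := spiderList_participation_ge hb hℓ ht0 hhh hρ0 hcpos hvertex
  have hρ1 : ρ < 1 := by
    have hw01 : w 0 ≤ 1 := by
      calc w 0 ≤ ∑ k, w k := Finset.single_le_sum (fun k _ => hw0 k) (mem_univ 0)
        _ = 1 := hw1
    have : (1 - t) * w 0 / (((b * ℓ : ℕ) : ℝ) + 1) ≤ (1 - t) * w 0 := div_le_self hhh.le (by linarith)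
    nlinarith
  refine ⟨ρ, hρ0, ?_, ?_, hfloorρ, le_trans ?_ htwo.1, htwo.2⟩
  · rw [div_le_div_iff₀ (by positivity) hρ0, one_mul]
    have := hlin
    rw [le_div_iff₀ (by positivity)] at this
    linarith
  · rw [div_le_div_iff₀ hhh hρ0, one_mul]
    have h1 : (((b * ℓ : ℕ) : ℝ) + 1) * ρ ≤ (((b * ℓ : ℕ) : ℝ) + 1) * ((1 - t) * w 0 / (((b * ℓ : ℕ) : ℝ) + 1)) := mul_le_mul_of_nonneg_left hρle (by positivity)
    rw [mul_div_cancel₀ _ (by positivity)] at h1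
    exact h1
  · have hνu : ν u ≤ 1 := by
      calc ν u ≤ ∑ v, ν v := Finset.single_le_sum (fun v _ => (hν v).le) (mem_univ u)
        _ = 1 := hν1
    have hcoef : 0 ≤ (1 - ρ) / ρ := div_nonneg (by linarith) hρ0.le
    rcases eq_or_lt_of_le hνu with heq | hlt
    · rw [heq]; simp
    · have hA : 0 < (1 - ν u) * Real.sqrt (((ℓ : ℝ) + 1) / 4) / 4 := by
        have : 0 < Real.sqrt (((ℓ : ℝ) + 1) / 4) := Real.sqrt_pos.mpr (by positivity)
        have : 0 < 1 - ν u := by linarith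
        positivity
      refine floorLog_mono hcoef hA ?_
      have h4 : (1 - ν u) * Real.sqrt (((ℓ : ℝ) + 1) / 4) / 4 = (1 - ν u) / 4 * Real.sqrt (((ℓ : ℝ) + 1) / 4) := by ring
      have h5 : (1 - ν u) * (∑ k : Fin (b * ℓ + 1), c k) / (4 * Real.sqrt (∑ k : Fin (b * ℓ + 1), c k ^ 2))
          = (1 - ν u) / 4 * ((∑ k : Fin (b * ℓ + 1), c k) / Real.sqrt (∑ k : Fin (b * ℓ + 1), c k ^ 2)) := by ring
      rw [h4, h5]
      exact mul_le_mul_of_nonneg_left hpart (by linarith)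

end Spider

end Summit.Ventures.LatticeQCDFlow.Scaling

end
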